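import Mathlib
import HarnessLib
import Summits.HubbardSuperconductivity.HubbardSuperconductivity.Theorems.KLProgrammePerturbedFermiCurveCompDiff
import Summits.HubbardSuperconductivity.HubbardSuperconductivity.Theorems.KLProgrammePerturbedFermiCurveCompChainStruct
import Summits.HubbardSuperconductivity.HubbardSuperconductivity.Theorems.KLProgrammePerturbedFermiCurveHigherDerivsBand
import Summits.HubbardSuperconductivity.HubbardSuperconductivity.Theorems.KLProgrammeFermiSurfaceFST2Regularity

/-!
# Route `KLProgramme`, crux K3 — engine-flow child (stmt-HubbardSuperconductivity-20437), stub (C) `stub_twoLeg_curvature`, (C1) door, FAR part: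
# the band energy and the flat cutoff ALONG A DISPLACED CURVE `θ ↦ γ(θ) − w` vary SLOWLY (co-moving chart) — translate lemma + jets

Cell gate-hubbard-kl, seat hubbard-kl-k3c3-p3 (g6; row «implicit-function / monotonicity route for μ(n)»).  The far (cutoff-shell) part of the
Jackson remainder on the new curve (k3c3-p1's door `jacksonRemainder_curve_jets`, term `(B l + Ml l)·τ`) needs sizes of
`θ ↦ χ_flat(e(γ(θ) − w))·g(angle(γ(θ) − w))` for displacements `w` of the size of the kernel's radius.  In the GENERIC chart these are the
global sizes of `klFrameExtFn` (Tier formula, `≈ 10¹⁰–10¹⁷` at order 4 — unusable below n ≈ 8, KL STATUS 2026-08-27 13:32:42Z (2)); along the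
displaced curve the band energy `φ_w(θ) = e(γ(θ) − w)` has jets `≤ (jets of e∘γ) + ‖w‖·T_j` with `T_j` LINEAR in the band's sizes — small,
because `e∘γ` is the frame's own (tiny) profile on its curve and `‖w‖ ≲ 2π/(d+1)`.  This file proves that layer, model-free:
* §0 `norm_iteratedFDeriv_freeBand_le`: ALL derivatives of order `≥ 1` of `q ↦ squareDispersion 1 0 q − μ` on `Momentum` have norm `≤ 4` (smoothness: `klfs_contDiff_e`);
* §1 **`abs_iteratedDeriv_comp_translate_sub_le`** (any normed `V`, `F ∈ C⁵` with global nested sizes `M₁…M₅`, `γ ∈ C⁴` with jets `D_i` at `θ`):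
  `|∂ʲ(F∘(γ−w))(θ) − ∂ʲ(F∘γ)(θ)| ≤ ‖w‖·T_j`, `T₁ = M₂D₁`, `T₂ = M₃D₁² + M₂D₂`, `T₃ = M₄D₁³ + 3M₃D₁D₂ + M₂D₃`,
  `T₄ = M₅D₁⁴ + 6M₄D₁²D₂ + 3M₃D₂² + 4M₃D₁D₃ + M₂D₄` (my `…CompDiff` with a constant shift: all curve-jet differences vanish);
* §2 **`freeBand_displaced_jets`**: `|φ_w^{(j)}(θ)| ≤ β_j + ‖w‖·T_j(4; D)` given `|∂ʲ(e∘γ)(θ)| ≤ β_j` (for a frame's curve `e∘γ_K = K∘γ_K`);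
* §3 **`cutoff_displaced_jets`**: for `χ ∈ C⁴(ℝ)` with `|χ^{(l)}| ≤ X_l`, `|∂ᵏ[χ∘φ_w](θ)| ≤` Bell(`X`, `φ̄`) (`X₁φ̄₁`; `X₂φ̄₁² + X₁φ̄₂`;
  `X₃φ̄₁³ + 3X₂φ̄₁φ̄₂ + X₁φ̄₃`; `X₄φ̄₁⁴ + 6X₃φ̄₁²φ̄₂ + 3X₂φ̄₂² + 4X₂φ̄₁φ̄₃ + X₁φ̄₄`) — every term carries at least one small factor `φ̄`.
Pure analysis; nothing about the model is asserted.  BGM 2006 §2.4 (2.36)/(2.40) [cite: BenfattoGiulianiMastropietro2006].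
-/

noncomputable section

namespace Summit.HubbardSuperconductivity.HubbardSuperconductivity.Theorems.PerturbedFermiCurve

set_option linter.dupNamespace false -- summit = problem name (single-conjunct summit), D-0017
set_option maxSynthPendingDepth 4 -- nested operator-norm instances (up to fifth Fréchet derivatives)

open Real Set Literature.MathematicalPhysics.QuantumLattice

/-! ## §0 The free band on `Momentum`: all derivatives bounded by `4` -/

/-- `‖Dⁱ (q ↦ cos (q c))‖ ≤ 1` on `Momentum` (the coordinate projection has norm `≤ 1`). -/
theorem norm_iteratedFDeriv_cos_coord_le (c : Fin 2) (i : ℕ) (q : Momentum) :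
    ‖iteratedFDeriv ℝ i (fun q : Momentum => Real.cos (q c)) q‖ ≤ 1 := by
  set Lc : Momentum →L[ℝ] ℝ := EuclideanSpace.proj c with hLc
  have hfun : (fun q : Momentum => Real.cos (q c)) = Real.cos ∘ Lc := by funext q; simp [hLc]
  have hnL : ‖Lc‖ ≤ 1 := ContinuousLinearMap.opNorm_le_bound _ zero_le_one fun v => by
    rw [one_mul]; simpa [hLc] using PiLp.norm_apply_le v c
  rw [hfun, ContinuousLinearMap.iteratedFDeriv_comp_right Lc Real.contDiff_cos q (i := i) le_top]
  refine (ContinuousMultilinearMap.norm_compContinuousLinearMap_le _ _).trans ?_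
  rw [Finset.prod_const, Finset.card_univ, Fintype.card_fin, norm_iteratedFDeriv_eq_norm_iteratedDeriv, Real.norm_eq_abs]
  calc |iteratedDeriv i Real.cos (Lc q)| * ‖Lc‖ ^ i ≤ 1 * 1 ^ i :=
        mul_le_mul (Real.abs_iteratedDeriv_cos_le_one i _) (pow_le_pow_left₀ (norm_nonneg _) hnL i) (by positivity) zero_le_one
    _ = 1 := by simp

/-- **All derivatives of order `i ≥ 1` of the free band on `Momentum` have norm `≤ 4`.** -/
theorem norm_iteratedFDeriv_freeBand_le (μ : ℝ) {i : ℕ} (hi : 1 ≤ i) (q : Momentum) :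
    ‖iteratedFDeriv ℝ i (fun q : Momentum => squareDispersion 1 0 q - μ) q‖ ≤ 4 := by
  have hp : ∀ c : Fin 2, ContDiff ℝ i (fun q : Momentum => (q c : ℝ)) := fun c => by
    simpa using (EuclideanSpace.proj c : Momentum →L[ℝ] ℝ).contDiff
  have hc0 : ContDiff ℝ i (fun q : Momentum => Real.cos (q 0)) := Real.contDiff_cos.comp (hp 0)
  have hc1 : ContDiff ℝ i (fun q : Momentum => Real.cos (q 1)) := Real.contDiff_cos.comp (hp 1)
  have hsum : ContDiff ℝ i ((fun q : Momentum => Real.cos (q 0)) + fun q : Momentum => Real.cos (q 1)) := hc0.add hc1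
  have hfun : (fun q : Momentum => squareDispersion 1 0 q - μ) =
      ((-2 : ℝ) • ((fun q : Momentum => Real.cos (q 0)) + fun q : Momentum => Real.cos (q 1))) + fun _ => -μ := by
    funext q; simp [squareDispersion, smul_eq_mul]; ring
  have hi0 : i ≠ 0 := by omega
  have hs : ContDiff ℝ i ((-2 : ℝ) • ((fun q : Momentum => Real.cos (q 0)) + fun q : Momentum => Real.cos (q 1))) := hsum.const_smul (-2 : ℝ)
  have hk : ContDiff ℝ i (fun _ : Momentum => -μ) := contDiff_const
  rw [hfun, iteratedFDeriv_add_apply hs.contDiffAt hk.contDiffAt, iteratedFDeriv_const_of_ne hi0,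
    Pi.zero_apply, add_zero, iteratedFDeriv_const_smul_apply hsum.contDiffAt, norm_smul, iteratedFDeriv_add_apply hc0.contDiffAt hc1.contDiffAt]
  calc ‖(-2 : ℝ)‖ * ‖iteratedFDeriv ℝ i (fun q : Momentum => Real.cos (q 0)) q + iteratedFDeriv ℝ i (fun q : Momentum => Real.cos (q 1)) q‖
      ≤ 2 * (1 + 1) := by
        rw [show ‖(-2 : ℝ)‖ = 2 by norm_num]
        exact mul_le_mul_of_nonneg_left ((norm_add_le _ _).trans (add_le_add (norm_iteratedFDeriv_cos_coord_le 0 i q)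
          (norm_iteratedFDeriv_cos_coord_le 1 i q))) (by norm_num)
    _ = 4 := by norm_num

/-! ## §1 The translate lemma: `F ∘ (γ − w)` against `F ∘ γ` -/

section Translate

variable {V : Type*} [NormedAddCommGroup V] [NormedSpace ℝ V] {F : V → ℝ} (hF : ContDiff ℝ 5 F) {γ : ℝ → V} (hγ : ContDiff ℝ 4 γ)
  (w : V) {θ M₁ M₂ M₃ M₄ M₅ D₁ D₂ D₃ D₄ : ℝ}
  (hM₁ : ∀ z, ‖fderiv ℝ F z‖ ≤ M₁) (hM₂ : ∀ z, ‖fderiv ℝ (fderiv ℝ F) z‖ ≤ M₂)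
  (hM₃ : ∀ z, ‖fderiv ℝ (fderiv ℝ (fderiv ℝ F)) z‖ ≤ M₃) (hM₄ : ∀ z, ‖fderiv ℝ (fderiv ℝ (fderiv ℝ (fderiv ℝ F))) z‖ ≤ M₄)
  (hM₅ : ∀ z, ‖fderiv ℝ (fderiv ℝ (fderiv ℝ (fderiv ℝ (fderiv ℝ F)))) z‖ ≤ M₅)
  (hD₁ : ‖iteratedDeriv 1 γ θ‖ ≤ D₁) (hD₂ : ‖iteratedDeriv 2 γ θ‖ ≤ D₂) (hD₃ : ‖iteratedDeriv 3 γ θ‖ ≤ D₃) (hD₄ : ‖iteratedDeriv 4 γ θ‖ ≤ D₄)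

include hγ in
/-- The displaced curve `γ − w` is `C⁴`. -/
theorem contDiff_translate : ContDiff ℝ 4 (fun θ : ℝ => γ θ - w) := hγ.sub contDiff_const

include hγ in
/-- The displaced curve has the same jets: `∂ⁱ(γ − w) = ∂ⁱγ` for `i ≥ 1`. -/
theorem iteratedDeriv_translate {i : ℕ} (hi : 1 ≤ i) (hi4 : i ≤ 4) (θ : ℝ) :
    iteratedDeriv i (fun θ : ℝ => γ θ - w) θ = iteratedDeriv i γ θ := by
  have hfun : (fun θ : ℝ => γ θ - w) = γ - fun _ => w := rfl
  have hi' : (i : WithTop ℕ∞) ≤ 4 := by exact_mod_cast hi4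
  rw [hfun, iteratedDeriv_sub (hγ.contDiffAt.of_le hi') contDiff_const.contDiffAt, iteratedDeriv_const]
  simp [show i ≠ 0 by omega]

include hF hM₁ in
/-- **Order 0**: `|F(γθ − w) − F(γθ)| ≤ M₁‖w‖`. -/
theorem abs_comp_translate_sub_le : |F (γ θ - w) - F (γ θ)| ≤ M₁ * ‖w‖ := by
  have h := (convex_univ).norm_image_sub_le_of_norm_fderiv_le (𝕜 := ℝ) (f := F)
    (fun z _ => (hF.differentiable (by norm_num)) z) (fun z _ => hM₁ z) (mem_univ (γ θ)) (mem_univ (γ θ - w))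
  rw [Real.norm_eq_abs] at h
  refine h.trans (le_of_eq ?_)
  rw [show γ θ - w - γ θ = -w by abel, norm_neg]

include hF hγ hM₁ hM₂ hD₁ in
/-- **Order 1**: `|∂(F∘(γ−w))(θ) − ∂(F∘γ)(θ)| ≤ ‖w‖·M₂D₁`. -/
theorem abs_iteratedDeriv_one_comp_translate_sub_le :
    |iteratedDeriv 1 (F ∘ fun θ : ℝ => γ θ - w) θ - iteratedDeriv 1 (F ∘ γ) θ| ≤ ‖w‖ * (M₂ * D₁) := by
  have hγw := contDiff_translate hγ w
  have hΦ₁ : ‖fderiv ℝ F (γ θ - w) - fderiv ℝ F (γ θ)‖ ≤ M₂ * ‖w‖ := by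
    have h := norm_fderiv_sub_le_of_global hF hM₂ (γ θ - w) (γ θ)
    rwa [show γ θ - w - γ θ = -w by abel, norm_neg] at h
  have hD₁' : ‖iteratedDeriv 1 (fun θ : ℝ => γ θ - w) θ‖ ≤ D₁ := by rw [iteratedDeriv_translate hγ w le_rfl (by norm_num)]; exact hD₁
  have hdD₁ : ‖iteratedDeriv 1 (fun θ : ℝ => γ θ - w) θ - iteratedDeriv 1 γ θ‖ ≤ 0 := by
    rw [iteratedDeriv_translate hγ w le_rfl (by norm_num), sub_self, norm_zero]
  have h := abs_iteratedDeriv_one_comp_sub_le (hF.of_le (by norm_num)) hγ hγw (hM₁ _) hΦ₁ hD₁' hdD₁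
  calc _ ≤ M₂ * ‖w‖ * D₁ + M₁ * 0 := h
    _ = ‖w‖ * (M₂ * D₁) := by ring

include hF hγ hM₁ hM₂ hM₃ hD₁ hD₂ in
/-- **Order 2**: `≤ ‖w‖·(M₃D₁² + M₂D₂)`. -/
theorem abs_iteratedDeriv_two_comp_translate_sub_le :
    |iteratedDeriv 2 (F ∘ fun θ : ℝ => γ θ - w) θ - iteratedDeriv 2 (F ∘ γ) θ| ≤ ‖w‖ * (M₃ * D₁ ^ 2 + M₂ * D₂) := by
  have hγw := contDiff_translate hγ w
  have e0 : γ θ - w - γ θ = -w := by abel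
  have hΦ₁ : ‖fderiv ℝ F (γ θ - w) - fderiv ℝ F (γ θ)‖ ≤ M₂ * ‖w‖ := by
    have h := norm_fderiv_sub_le_of_global hF hM₂ (γ θ - w) (γ θ); rwa [e0, norm_neg] at h
  have hΦ₂ : ‖fderiv ℝ (fderiv ℝ F) (γ θ - w) - fderiv ℝ (fderiv ℝ F) (γ θ)‖ ≤ M₃ * ‖w‖ := by
    have h := norm_fderiv_two_sub_le_of_global hF hM₃ (γ θ - w) (γ θ); rwa [e0, norm_neg] at h
  have hD₁' : ‖iteratedDeriv 1 (fun θ : ℝ => γ θ - w) θ‖ ≤ D₁ := by rw [iteratedDeriv_translate hγ w le_rfl (by norm_num)]; exact hD₁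
  have hD₂' : ‖iteratedDeriv 2 (fun θ : ℝ => γ θ - w) θ‖ ≤ D₂ := by rw [iteratedDeriv_translate hγ w (by norm_num) (by norm_num)]; exact hD₂
  have hdD₁ : ‖iteratedDeriv 1 (fun θ : ℝ => γ θ - w) θ - iteratedDeriv 1 γ θ‖ ≤ 0 := by
    rw [iteratedDeriv_translate hγ w le_rfl (by norm_num), sub_self, norm_zero]
  have hdD₂ : ‖iteratedDeriv 2 (fun θ : ℝ => γ θ - w) θ - iteratedDeriv 2 γ θ‖ ≤ 0 := by
    rw [iteratedDeriv_translate hγ w (by norm_num) (by norm_num), sub_self, norm_zero]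
  have h := abs_iteratedDeriv_two_comp_sub_le (hF.of_le (by norm_num)) hγ hγw (hM₁ _) (hM₂ _) hΦ₁ hΦ₂ hD₁ hD₁' hD₂' hdD₁ hdD₂
  calc _ ≤ M₃ * ‖w‖ * D₁ ^ 2 + 2 * M₂ * D₁ * 0 + M₂ * ‖w‖ * D₂ + M₁ * 0 := h
    _ = ‖w‖ * (M₃ * D₁ ^ 2 + M₂ * D₂) := by ring


include hF hγ hM₁ hM₂ hM₃ hM₄ hD₁ hD₂ hD₃ in
/-- **Order 3**: `≤ ‖w‖·(M₄D₁³ + 3M₃D₁D₂ + M₂D₃)`. -/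
theorem abs_iteratedDeriv_three_comp_translate_sub_le :
    |iteratedDeriv 3 (F ∘ fun θ : ℝ => γ θ - w) θ - iteratedDeriv 3 (F ∘ γ) θ| ≤
      ‖w‖ * (M₄ * D₁ ^ 3 + 3 * M₃ * D₁ * D₂ + M₂ * D₃) := by
  have hγw := contDiff_translate hγ w
  have e0 : γ θ - w - γ θ = -w := by abel
  have hΦ₁ : ‖fderiv ℝ F (γ θ - w) - fderiv ℝ F (γ θ)‖ ≤ M₂ * ‖w‖ := by
    have h := norm_fderiv_sub_le_of_global hF hM₂ (γ θ - w) (γ θ); rwa [e0, norm_neg] at h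
  have hΦ₂ : ‖fderiv ℝ (fderiv ℝ F) (γ θ - w) - fderiv ℝ (fderiv ℝ F) (γ θ)‖ ≤ M₃ * ‖w‖ := by
    have h := norm_fderiv_two_sub_le_of_global hF hM₃ (γ θ - w) (γ θ); rwa [e0, norm_neg] at h
  have hΦ₃ : ‖fderiv ℝ (fderiv ℝ (fderiv ℝ F)) (γ θ - w) - fderiv ℝ (fderiv ℝ (fderiv ℝ F)) (γ θ)‖ ≤ M₄ * ‖w‖ := by
    have h := norm_fderiv_three_sub_le_of_global hF hM₄ (γ θ - w) (γ θ); rwa [e0, norm_neg] at h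
  have hD₁' : ‖iteratedDeriv 1 (fun θ : ℝ => γ θ - w) θ‖ ≤ D₁ := by
    rw [iteratedDeriv_translate hγ w le_rfl (by norm_num)]; exact hD₁
  have hD₂' : ‖iteratedDeriv 2 (fun θ : ℝ => γ θ - w) θ‖ ≤ D₂ := by
    rw [iteratedDeriv_translate hγ w (by norm_num) (by norm_num)]; exact hD₂
  have hD₃' : ‖iteratedDeriv 3 (fun θ : ℝ => γ θ - w) θ‖ ≤ D₃ := by
    rw [iteratedDeriv_translate hγ w (by norm_num) (by norm_num)]; exact hD₃
  have hdD₁ : ‖iteratedDeriv 1 (fun θ : ℝ => γ θ - w) θ - iteratedDeriv 1 γ θ‖ ≤ 0 := by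
    rw [iteratedDeriv_translate hγ w le_rfl (by norm_num), sub_self, norm_zero]
  have hdD₂ : ‖iteratedDeriv 2 (fun θ : ℝ => γ θ - w) θ - iteratedDeriv 2 γ θ‖ ≤ 0 := by
    rw [iteratedDeriv_translate hγ w (by norm_num) (by norm_num), sub_self, norm_zero]
  have hdD₃ : ‖iteratedDeriv 3 (fun θ : ℝ => γ θ - w) θ - iteratedDeriv 3 γ θ‖ ≤ 0 := by
    rw [iteratedDeriv_translate hγ w (by norm_num) (by norm_num), sub_self, norm_zero]
  have h := abs_iteratedDeriv_three_comp_sub_le (hF.of_le (by norm_num)) hγ hγw (hM₁ _) (hM₂ _) (hM₃ _) hΦ₁ hΦ₂ hΦ₃ hD₁ hD₁' hD₂ hD₂'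
    hD₃' hdD₁ hdD₂ hdD₃
  calc _ ≤ M₄ * ‖w‖ * D₁ ^ 3 + 3 * M₃ * 0 * D₁ ^ 2 + 3 * (M₃ * ‖w‖ * D₁ * D₂ + M₂ * (0 * D₂ + D₁ * 0)) + M₂ * ‖w‖ * D₃ + M₁ * 0 := h
    _ = ‖w‖ * (M₄ * D₁ ^ 3 + 3 * M₃ * D₁ * D₂ + M₂ * D₃) := by ring

include hF hγ hM₁ hM₂ hM₃ hM₄ hM₅ hD₁ hD₂ hD₃ hD₄ in
/-- **Order 4**: `≤ ‖w‖·(M₅D₁⁴ + 6M₄D₁²D₂ + 3M₃D₂² + 4M₃D₁D₃ + M₂D₄)`. -/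
theorem abs_iteratedDeriv_four_comp_translate_sub_le :
    |iteratedDeriv 4 (F ∘ fun θ : ℝ => γ θ - w) θ - iteratedDeriv 4 (F ∘ γ) θ| ≤
      ‖w‖ * (M₅ * D₁ ^ 4 + 6 * M₄ * D₁ ^ 2 * D₂ + 3 * M₃ * D₂ ^ 2 + 4 * M₃ * D₁ * D₃ + M₂ * D₄) := by
  have hγw := contDiff_translate hγ w
  have e0 : γ θ - w - γ θ = -w := by abel
  have hΦ₁ : ‖fderiv ℝ F (γ θ - w) - fderiv ℝ F (γ θ)‖ ≤ M₂ * ‖w‖ := by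
    have h := norm_fderiv_sub_le_of_global hF hM₂ (γ θ - w) (γ θ); rwa [e0, norm_neg] at h
  have hΦ₂ : ‖fderiv ℝ (fderiv ℝ F) (γ θ - w) - fderiv ℝ (fderiv ℝ F) (γ θ)‖ ≤ M₃ * ‖w‖ := by
    have h := norm_fderiv_two_sub_le_of_global hF hM₃ (γ θ - w) (γ θ); rwa [e0, norm_neg] at h
  have hΦ₃ : ‖fderiv ℝ (fderiv ℝ (fderiv ℝ F)) (γ θ - w) - fderiv ℝ (fderiv ℝ (fderiv ℝ F)) (γ θ)‖ ≤ M₄ * ‖w‖ := by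
    have h := norm_fderiv_three_sub_le_of_global hF hM₄ (γ θ - w) (γ θ); rwa [e0, norm_neg] at h
  have hΦ₄ : ‖fderiv ℝ (fderiv ℝ (fderiv ℝ (fderiv ℝ F))) (γ θ - w) - fderiv ℝ (fderiv ℝ (fderiv ℝ (fderiv ℝ F))) (γ θ)‖ ≤
      M₅ * ‖w‖ := by
    have h := norm_fderiv_four_sub_le_of_global hF hM₅ (γ θ - w) (γ θ); rwa [e0, norm_neg] at h
  have hD₁' : ‖iteratedDeriv 1 (fun θ : ℝ => γ θ - w) θ‖ ≤ D₁ := by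
    rw [iteratedDeriv_translate hγ w le_rfl (by norm_num)]; exact hD₁
  have hD₂' : ‖iteratedDeriv 2 (fun θ : ℝ => γ θ - w) θ‖ ≤ D₂ := by
    rw [iteratedDeriv_translate hγ w (by norm_num) (by norm_num)]; exact hD₂
  have hD₃' : ‖iteratedDeriv 3 (fun θ : ℝ => γ θ - w) θ‖ ≤ D₃ := by
    rw [iteratedDeriv_translate hγ w (by norm_num) (by norm_num)]; exact hD₃
  have hD₄' : ‖iteratedDeriv 4 (fun θ : ℝ => γ θ - w) θ‖ ≤ D₄ := by
    rw [iteratedDeriv_translate hγ w (by norm_num) (by norm_num)]; exact hD₄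
  have hdD₁ : ‖iteratedDeriv 1 (fun θ : ℝ => γ θ - w) θ - iteratedDeriv 1 γ θ‖ ≤ 0 := by
    rw [iteratedDeriv_translate hγ w le_rfl (by norm_num), sub_self, norm_zero]
  have hdD₂ : ‖iteratedDeriv 2 (fun θ : ℝ => γ θ - w) θ - iteratedDeriv 2 γ θ‖ ≤ 0 := by
    rw [iteratedDeriv_translate hγ w (by norm_num) (by norm_num), sub_self, norm_zero]
  have hdD₃ : ‖iteratedDeriv 3 (fun θ : ℝ => γ θ - w) θ - iteratedDeriv 3 γ θ‖ ≤ 0 := by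
    rw [iteratedDeriv_translate hγ w (by norm_num) (by norm_num), sub_self, norm_zero]
  have hdD₄ : ‖iteratedDeriv 4 (fun θ : ℝ => γ θ - w) θ - iteratedDeriv 4 γ θ‖ ≤ 0 := by
    rw [iteratedDeriv_translate hγ w (by norm_num) (by norm_num), sub_self, norm_zero]
  have h := abs_iteratedDeriv_four_comp_sub_le (hF.of_le (by norm_num)) hγ hγw (hM₁ _) (hM₂ _) (hM₃ _) (hM₄ _) hΦ₁ hΦ₂ hΦ₃ hΦ₄
    hD₁ hD₁' hD₂ hD₂' hD₃ hD₃' hD₄' hdD₁ hdD₂ hdD₃ hdD₄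
  calc _ ≤ M₅ * ‖w‖ * D₁ ^ 4 + 4 * M₄ * 0 * D₁ ^ 3 + 6 * (M₄ * ‖w‖ * D₁ ^ 2 * D₂ + M₃ * (0 * D₁ ^ 2 + 2 * D₁ * D₂ * 0)) +
        3 * (M₃ * ‖w‖ * D₂ ^ 2 + 2 * M₂ * D₂ * 0) + 4 * (M₃ * ‖w‖ * D₁ * D₃ + M₂ * (0 * D₃ + D₁ * 0)) + M₂ * ‖w‖ * D₄ + M₁ * 0 := h
    _ = ‖w‖ * (M₅ * D₁ ^ 4 + 6 * M₄ * D₁ ^ 2 * D₂ + 3 * M₃ * D₂ ^ 2 + 4 * M₃ * D₁ * D₃ + M₂ * D₄) := by ring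

end Translate


/-! ## §2 The band energy along a displaced curve -/

section Band

variable (μ : ℝ) {γ : ℝ → Momentum} (hγ : ContDiff ℝ 4 γ) (w : Momentum) {θ D₁ D₂ D₃ D₄ β₁ β₂ β₃ β₄ : ℝ}
  (hD₁ : ‖iteratedDeriv 1 γ θ‖ ≤ D₁) (hD₂ : ‖iteratedDeriv 2 γ θ‖ ≤ D₂) (hD₃ : ‖iteratedDeriv 3 γ θ‖ ≤ D₃) (hD₄ : ‖iteratedDeriv 4 γ θ‖ ≤ D₄)
  (hβ₁ : |iteratedDeriv 1 (fun θ : ℝ => squareDispersion 1 0 (γ θ) - μ) θ| ≤ β₁)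
  (hβ₂ : |iteratedDeriv 2 (fun θ : ℝ => squareDispersion 1 0 (γ θ) - μ) θ| ≤ β₂)
  (hβ₃ : |iteratedDeriv 3 (fun θ : ℝ => squareDispersion 1 0 (γ θ) - μ) θ| ≤ β₃)
  (hβ₄ : |iteratedDeriv 4 (fun θ : ℝ => squareDispersion 1 0 (γ θ) - μ) θ| ≤ β₄)

/-- Nested-derivative sizes of the free band: `‖Dᵏe‖ ≤ 4`, `k = 1 … 5`. -/
theorem freeBand_nested_sizes (μ : ℝ) :
    (∀ z : Momentum, ‖fderiv ℝ (fun q : Momentum => squareDispersion 1 0 q - μ) z‖ ≤ 4) ∧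
    (∀ z : Momentum, ‖fderiv ℝ (fderiv ℝ (fun q : Momentum => squareDispersion 1 0 q - μ)) z‖ ≤ 4) ∧
    (∀ z : Momentum, ‖fderiv ℝ (fderiv ℝ (fderiv ℝ (fun q : Momentum => squareDispersion 1 0 q - μ))) z‖ ≤ 4) ∧
    (∀ z : Momentum, ‖fderiv ℝ (fderiv ℝ (fderiv ℝ (fderiv ℝ (fun q : Momentum => squareDispersion 1 0 q - μ)))) z‖ ≤ 4) ∧
    (∀ z : Momentum, ‖fderiv ℝ (fderiv ℝ (fderiv ℝ (fderiv ℝ (fderiv ℝ (fun q : Momentum => squareDispersion 1 0 q - μ))))) z‖ ≤ 4) := by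
  set e := fun q : Momentum => squareDispersion 1 0 q - μ with he
  refine ⟨fun z => ?_, fun z => ?_, fun z => ?_, fun z => ?_, fun z => ?_⟩
  · rw [norm_fderiv_eq_norm_iteratedFDeriv_one]; exact norm_iteratedFDeriv_freeBand_le μ le_rfl z
  · rw [norm_fderiv_two_eq_norm_iteratedFDeriv]; exact norm_iteratedFDeriv_freeBand_le μ (by norm_num) z
  · rw [norm_fderiv_three_eq_norm_iteratedFDeriv]; exact norm_iteratedFDeriv_freeBand_le μ (by norm_num) z
  · rw [norm_fderiv_four_eq_norm_iteratedFDeriv]; exact norm_iteratedFDeriv_freeBand_le μ (by norm_num) z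
  · rw [norm_fderiv_four_eq_norm_iteratedFDeriv (fderiv ℝ e) z, norm_iteratedFDeriv_fderiv]
    exact norm_iteratedFDeriv_freeBand_le μ (by norm_num) z

include hγ hD₁ hD₂ hD₃ hD₄ hβ₁ hβ₂ hβ₃ hβ₄ in
/-- **The band along the displaced curve `γ − w`**: `φ_w(θ) = e(γ(θ) − w)` is `C⁴` with
`|φ_w′| ≤ β₁ + 4‖w‖D₁`, `|φ_w″| ≤ β₂ + 4‖w‖(D₁² + D₂)`, `|φ_w‴| ≤ β₃ + 4‖w‖(D₁³ + 3D₁D₂ + D₃)`,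
`|φ_w⁗| ≤ β₄ + 4‖w‖(D₁⁴ + 6D₁²D₂ + 3D₂² + 4D₁D₃ + D₄)`, where `β_j` bound the jets of `e∘γ` (the frame's own profile on its curve). -/
theorem freeBand_displaced_jets :
    ContDiff ℝ 4 (fun θ : ℝ => squareDispersion 1 0 (γ θ - w) - μ) ∧
    |iteratedDeriv 1 (fun θ : ℝ => squareDispersion 1 0 (γ θ - w) - μ) θ| ≤ β₁ + 4 * ‖w‖ * D₁ ∧
    |iteratedDeriv 2 (fun θ : ℝ => squareDispersion 1 0 (γ θ - w) - μ) θ| ≤ β₂ + 4 * ‖w‖ * (D₁ ^ 2 + D₂) ∧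
    |iteratedDeriv 3 (fun θ : ℝ => squareDispersion 1 0 (γ θ - w) - μ) θ| ≤ β₃ + 4 * ‖w‖ * (D₁ ^ 3 + 3 * D₁ * D₂ + D₃) ∧
    |iteratedDeriv 4 (fun θ : ℝ => squareDispersion 1 0 (γ θ - w) - μ) θ| ≤
      β₄ + 4 * ‖w‖ * (D₁ ^ 4 + 6 * D₁ ^ 2 * D₂ + 3 * D₂ ^ 2 + 4 * D₁ * D₃ + D₄) := by
  set e := fun q : Momentum => squareDispersion 1 0 q - μ with he
  have hF : ContDiff ℝ 5 e := klfs_contDiff_e μ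
  obtain ⟨m1, m2, m3, m4, m5⟩ := freeBand_nested_sizes μ
  have hcw : (fun θ : ℝ => squareDispersion 1 0 (γ θ - w) - μ) = e ∘ fun θ : ℝ => γ θ - w := rfl
  have hc0 : (fun θ : ℝ => squareDispersion 1 0 (γ θ) - μ) = e ∘ γ := rfl
  rw [hcw]
  rw [hc0] at hβ₁ hβ₂ hβ₃ hβ₄
  have t1 := abs_iteratedDeriv_one_comp_translate_sub_le hF hγ w m1 m2 hD₁ (θ := θ)
  have t2 := abs_iteratedDeriv_two_comp_translate_sub_le hF hγ w m1 m2 m3 hD₁ hD₂ (θ := θ)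
  have t3 := abs_iteratedDeriv_three_comp_translate_sub_le hF hγ w m1 m2 m3 m4 hD₁ hD₂ hD₃ (θ := θ)
  have t4 := abs_iteratedDeriv_four_comp_translate_sub_le hF hγ w m1 m2 m3 m4 m5 hD₁ hD₂ hD₃ hD₄ (θ := θ)
  have tri : ∀ {a b x y : ℝ}, |a - b| ≤ x → |b| ≤ y → |a| ≤ y + x := by
    intro a b x y h1 h2
    have := abs_sub_abs_le_abs_sub a b
    linarith
  refine ⟨(hF.of_le (by norm_num)).comp (contDiff_translate hγ w), ?_, ?_, ?_, ?_⟩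
  · exact (tri t1 hβ₁).trans (le_of_eq (by ring))
  · exact (tri t2 hβ₂).trans (le_of_eq (by ring))
  · exact (tri t3 hβ₃).trans (le_of_eq (by ring))
  · exact (tri t4 hβ₄).trans (le_of_eq (by ring))

end Band

/-! ## §3 A cutoff along the displaced curve: every term carries a small factor -/

section Cutoff

variable {χ φ : ℝ → ℝ} (hχ : ContDiff ℝ 4 χ) (hφ : ContDiff ℝ 4 φ) {X : ℕ → ℝ} (hX : ∀ l, 1 ≤ l → l ≤ 4 → ∀ t : ℝ, |iteratedDeriv l χ t| ≤ X l)
  {θ P₁ P₂ P₃ P₄ : ℝ} (hP₁ : |iteratedDeriv 1 φ θ| ≤ P₁) (hP₂ : |iteratedDeriv 2 φ θ| ≤ P₂) (hP₃ : |iteratedDeriv 3 φ θ| ≤ P₃)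
  (hP₄ : |iteratedDeriv 4 φ θ| ≤ P₄)
include hχ hφ hX hP₁ hP₂ hP₃ hP₄

/-- **The cutoff along the displaced curve**: for `χ ∈ C⁴(ℝ)` with `|χ^{(l)}| ≤ X l` and an inner function with jets `P_j` (e.g. the displaced band
`φ_w` of `freeBand_displaced_jets`): `|∂(χ∘φ)| ≤ X₁P₁`, `|∂²| ≤ X₂P₁² + X₁P₂`, `|∂³| ≤ X₃P₁³ + 3X₂P₁P₂ + X₁P₃`,
`|∂⁴| ≤ X₄P₁⁴ + 6X₃P₁²P₂ + 3X₂P₂² + 4X₂P₁P₃ + X₁P₄` — every term has at least one factor `P`. -/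
theorem cutoff_displaced_jets :
    |iteratedDeriv 1 (χ ∘ φ) θ| ≤ X 1 * P₁ ∧
    |iteratedDeriv 2 (χ ∘ φ) θ| ≤ X 2 * P₁ ^ 2 + X 1 * P₂ ∧
    |iteratedDeriv 3 (χ ∘ φ) θ| ≤ X 3 * P₁ ^ 3 + 3 * X 2 * P₁ * P₂ + X 1 * P₃ ∧
    |iteratedDeriv 4 (χ ∘ φ) θ| ≤ X 4 * P₁ ^ 4 + 6 * X 3 * P₁ ^ 2 * P₂ + 3 * X 2 * P₂ ^ 2 + 4 * X 2 * P₁ * P₃ + X 1 * P₄ := by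
  have hM : ∀ l, 1 ≤ l → l ≤ 4 → ‖iteratedFDeriv ℝ l χ (φ θ)‖ ≤ X l := by
    intro l h1 h4
    rw [norm_iteratedFDeriv_eq_norm_iteratedDeriv, Real.norm_eq_abs]; exact hX l h1 h4 _
  have hD : ∀ {i : ℕ} {P : ℝ}, |iteratedDeriv i φ θ| ≤ P → ‖iteratedDeriv i φ θ‖ ≤ P := fun h => by
    rw [Real.norm_eq_abs]; exact h
  refine ⟨?_, ?_, ?_, ?_⟩
  · exact abs_iteratedDeriv_one_comp_le_struct hχ hφ (hM 1 le_rfl (by norm_num)) (hD hP₁)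
  · exact abs_iteratedDeriv_two_comp_le_struct hχ hφ (hM 1 le_rfl (by norm_num)) (hM 2 (by norm_num) (by norm_num)) (hD hP₁) (hD hP₂)
  · exact abs_iteratedDeriv_three_comp_le_struct hχ hφ (hM 1 le_rfl (by norm_num)) (hM 2 (by norm_num) (by norm_num))
      (hM 3 (by norm_num) (by norm_num)) (hD hP₁) (hD hP₂) (hD hP₃)
  · exact abs_iteratedDeriv_four_comp_le_struct hχ hφ (hM 1 le_rfl (by norm_num)) (hM 2 (by norm_num) (by norm_num))
      (hM 3 (by norm_num) (by norm_num)) (hM 4 (by norm_num) le_rfl) (hD hP₁) (hD hP₂) (hD hP₃) (hD hP₄)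

end Cutoff

end Summit.HubbardSuperconductivity.HubbardSuperconductivity.Theorems.PerturbedFermiCurve

end
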